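import Summits.BirchSwinnertonDyer.BirchSwinnertonDyer.Theorems.SchneiderFreeAdditiveX3UpperRowPrimes
import HarnessLib

/-!
# Route `SchneiderFreeAdditiveX3Upper` (K1 door, upper wing): the DECIDING crux r2 `TwistUnitX3OffSliver` (item 20364) is VACUOUS off the
# census primes, and the rung leaf `Upper.AdditiveX3RankOneUpper` needs the three upper cruxes ONLY at their row primes
# (`PrintedFacts`, the PROVED `ControlFacts`, Mazur's two isogeny theorems displayed)

Cell `bsd-schneider-ideate`, seat `bsd-schneider-door-c5` (prover, generation 36; assembly layer; `--supports` 20364 — record support for the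
sibling route; the upper-wing twin of generation 35's `KYBranchLeafRowPrimes` for the door route).  PARTITION: board row B6 ∩ X3 ∩ sst-twist,
`r = 1` (7 101 census pairs: 4 541 (M) + 2 560 (G-ord, `e = 2`), all at `p ∈ {3, 5, 7, 13}`; class-wide every odd `p`) of
`Rank1Residual.partition` — ASSEMBLY; types-the-object-of nothing new; closes nothing (BSD NOT advanced).  bears_on: K1-door upper wing
(route `SchneiderFreeAdditiveX3Upper`: items 20364 r2 `TwistUnitX3OffSliver` (deciding), 20365 r3 `GordTwoBranchCoIMCField`, 20366 r4
`PotMultBranchCoIMC`; Assembly 20367 closed).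

WHY.  All three upper cruxes quantify over every odd prime under `ClassX3 W p` (a rational `p`-isogeny) and a cell predicate (`SubM`:
`v_p(j) < 0`; `SubGordTwo`: `e = 2`; `SubSemistableTwist` = their union).  Generation 35 showed (Mazur's Thm. 1 `mazur_isogeny_irreducible` and
`j`-table `mazur_j_mem_of_not_hasIrreducibleModPGaloisRep_of_eleven_le` displayed; two elementary `j`-obstructions against `e = 2`; `p`-integrality
of the eleven moduli against `v_p(j) < 0`): the (M) row has primes in `{2, 3, 5, 7, 13}` (`KYBranchRowPrimesPotMult.mem_rowPrimesM_of_classX3_of_subM`)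
and the (G-ord, `e = 2`) row in `{2, 3, 5, 7, 13, 37}` (`KYBranchRowPrimes.mem_rowPrimes_of_classX3_of_subGordTwo`); `UpperRowPrimes` drew the
consequence for 20365/20366.  THIS FILE adds the deciding crux and the leaf:
* §1 **`twistUnitX3OffSliver_of_rowPrimes`** — item 20364 BY NAME from its OWN instances on the (M) row at `p ∈ {3, 5, 7, 13}` and on the
  (G-ord, `e = 2`) row at `p ∈ {3, 5, 7, 13, 37}` (VACUOUS elsewhere);
* §2 **`additiveX3RankOneUpper_of_printedFacts_of_rowPrimes`** — the upper-wing rung leaf `Upper.AdditiveX3RankOneUpper` (upper half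
  `ord_p #Ш ≤ ord_p #Ш_an` on the whole additive semistable-twist class, `r_an = 1`, every odd `p`) from `PrintedFacts`, Mazur's two theorems,
  and the three upper cruxes' OWN instances at those row primes — the route's `closes` with `ControlFacts` DISCHARGED by the tree's
  `ControlFacts_holds` (`controlFacts_proof`).

HONEST FRAMING: compositions of tree theorems, CONDITIONAL on every displayed hypothesis (`PrintedFacts` = thirteen published facts; Mazur's
theorems as named published facts; the instance families are exactly what items 20364/20365/20366 still owe — OPEN); no definition, no new
named fact, no `sorry`; nothing is closed; BSD is proved for no curve; «closes rung: none».
References: Mazur, Invent. Math. 44 (1978) Thm. 1, Thm. 7.1, table p. 129 [Mazur1978]; Lozano-Robledo, Math. Ann. 357 (2013) Table 4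
[LozanoRobledo2013MathAnn]; Darmon 2004 Thm. 3.22 [Darmon2004]; this seat p739034 (F24d), p739345 (F24e), p739574 (F24f).
-/

set_option autoImplicit false
-- `Summit.<P>.<Sub>` repeats `BirchSwinnertonDyer` by the tree's layout convention (D-0017)
set_option linter.dupNamespace false

noncomputable section

open scoped Classical

open WeierstrassCurve Literature.NumberTheory.EllipticCurves Literature.NumberTheory.EllipticCurves.Rank1Residual
  Literature.NumberTheory.EllipticCurves.KellerYin2024
  Summit.BirchSwinnertonDyer.Rank1Residual Summit.BirchSwinnertonDyer.BirchSwinnertonDyer.Theorems.SchneiderFree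
  Summit.BirchSwinnertonDyer.BirchSwinnertonDyer.Theses.SchneiderFreeAdditiveX3Upper

namespace Summit.BirchSwinnertonDyer.BirchSwinnertonDyer.Theorems.SchneiderFreeAdditiveX3.UpperLeafRowPrimes

/-! ### §1 The deciding crux r2 `TwistUnitX3OffSliver` from its row instances -/

/-- **Item 20364 `TwistUnitX3OffSliver` BY NAME is the conjunction of its OWN instances on the (M) row at `p ∈ {3, 5, 7, 13}` and on the
(G-ord, `e = 2`) row at `p ∈ {3, 5, 7, 13, 37}`**: at every other (cell, prime) the hypotheses `ClassX3 W p ∧ SubM W p`, resp.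
`ClassX3 W p ∧ SubGordTwo W p`, are contradictory (`KYBranchRowPrimesPotMult.mem_rowPrimesM_of_classX3_of_subM`,
`KYBranchRowPrimes.mem_rowPrimes_of_classX3_of_subGordTwo`; `p = 2` is the crux's own exclusion), so the crux holds VACUOUSLY there.
CONDITIONAL on Mazur's two displayed published facts; the mathematics of the instances (the off-sliver twist-unit datum
`Upper.TwistUnitFieldOffSliverAt W p`) is untouched; nothing is closed; BSD is NOT advanced.
[cite: Mazur1978, Thm. 1 and table p. 129] [cite: LozanoRobledo2013MathAnn, Table 4] -/
theorem twistUnitX3OffSliver_of_rowPrimes (hM : mazur_isogeny_irreducible)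
    (hJ : mazur_j_mem_of_not_hasIrreducibleModPGaloisRep_of_eleven_le)
    (hTM : ∀ (W : WeierstrassCurve ℚ) [W.IsElliptic] [W.IsGloballyMinimal] (p : ℕ) [Fact p.Prime],
      p = 3 ∨ p = 5 ∨ p = 7 ∨ p = 13 → W.analyticRank = 1 → ClassX3 W p → Additive.SubM W p → Upper.TwistUnitFieldOffSliverAt W p)
    (hTG : ∀ (W : WeierstrassCurve ℚ) [W.IsElliptic] [W.IsGloballyMinimal] (p : ℕ) [Fact p.Prime],
      p = 3 ∨ p = 5 ∨ p = 7 ∨ p = 13 ∨ p = 37 → W.analyticRank = 1 → ClassX3 W p → Additive.SubGordTwo W p →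
        Upper.TwistUnitFieldOffSliverAt W p) :
    TwistUnitX3OffSliver := by
  intro W _ _ p _ hr hp2 hX hS
  rcases hS with hSM | hSG
  · have hmem := KYBranchRowPrimesPotMult.mem_rowPrimesM_of_classX3_of_subM hM hJ W hX hSM
    simp only [Finset.mem_insert, Finset.mem_singleton] at hmem
    rcases hmem with h2 | h4
    · exact absurd h2 hp2
    · exact hTM W p h4 hr hX hSM
  · have hmem := KYBranchRowPrimes.mem_rowPrimes_of_classX3_of_subGordTwo hM hJ W hX hSG
    simp only [Finset.mem_insert, Finset.mem_singleton] at hmem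
    rcases hmem with h2 | h5
    · exact absurd h2 hp2
    · exact hTG W p h5 hr hX hSG

/-! ### §2 The upper-wing rung leaf from `PrintedFacts`, Mazur, and the row instances of the three upper cruxes -/

/-- **The K1 upper-wing rung leaf `Upper.AdditiveX3RankOneUpper` from `PrintedFacts`, Mazur's two isogeny theorems, and the three upper
cruxes' OWN instances at their row primes** — r3 (`GordTwoBranchCoIMCField`, field-local, (G-ord, `e = 2`) cell, `d_K ≠ −3`) at
`p ∈ {3, 5, 7, 13, 37}`, r4 (`PotMultBranchCoIMC`, (M) cell) at `p ∈ {3, 5, 7, 13}`, and the deciding r2 (`TwistUnitX3OffSliver`) on the (M)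
row at `p ∈ {3, 5, 7, 13}` and on the (G-ord, `e = 2`) row at `p ∈ {3, 5, 7, 13, 37}`: all three are vacuous elsewhere (`UpperRowPrimes`, §1),
`ControlFacts` is the tree's theorem `ControlFacts_holds`, and the leaf follows by the route's `closes`.  CONDITIONAL on all displayed
hypotheses; nothing is closed; BSD is NOT advanced.
[cite: Mazur1978, Thm. 1 and table p. 129] [cite: Darmon2004, Thm. 3.22 and §3.9] [cite: JetchevSkinnerWan2017, §7.4.1 (arXiv:1512.06894 p. 30)] -/
theorem additiveX3RankOneUpper_of_printedFacts_of_rowPrimes (hF : PrintedFacts) (hM : mazur_isogeny_irreducible)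
    (hJ : mazur_j_mem_of_not_hasIrreducibleModPGaloisRep_of_eleven_le)
    (h3 : ∀ (W : WeierstrassCurve ℚ) [W.IsElliptic] [W.IsGloballyMinimal] (p : ℕ) [Fact p.Prime],
      p = 3 ∨ p = 5 ∨ p = 7 ∨ p = 13 ∨ p = 37 → ClassX3 W p → Additive.SubGordTwo W p →
        (∃ Φ : AddSubgroup (WeierstrassCurve.geomTorsion W (p : ℤ)), IsRationalLine W p Φ ∧ ¬ LineDecompositionTrivialAt W p Φ) →
        ∀ (K : Type) [Field K] [NumberField K], IsImaginaryQuadratic K → NumberField.discr K ≠ -3 →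
          Upper.AdditiveIMCUpperBDPInputManinAtField W p K)
    (h4 : ∀ (W : WeierstrassCurve ℚ) [W.IsElliptic] [W.IsGloballyMinimal] (p : ℕ) [Fact p.Prime],
      p = 3 ∨ p = 5 ∨ p = 7 ∨ p = 13 → ClassX3 W p → Additive.SubM W p →
        (∃ Φ : AddSubgroup (WeierstrassCurve.geomTorsion W (p : ℤ)), IsRationalLine W p Φ ∧ ¬ LineDecompositionTrivialAt W p Φ) →
        Upper.AdditiveIMCUpperBDPInputManinAt W p)
    (hTM : ∀ (W : WeierstrassCurve ℚ) [W.IsElliptic] [W.IsGloballyMinimal] (p : ℕ) [Fact p.Prime],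
      p = 3 ∨ p = 5 ∨ p = 7 ∨ p = 13 → W.analyticRank = 1 → ClassX3 W p → Additive.SubM W p → Upper.TwistUnitFieldOffSliverAt W p)
    (hTG : ∀ (W : WeierstrassCurve ℚ) [W.IsElliptic] [W.IsGloballyMinimal] (p : ℕ) [Fact p.Prime],
      p = 3 ∨ p = 5 ∨ p = 7 ∨ p = 13 ∨ p = 37 → W.analyticRank = 1 → ClassX3 W p → Additive.SubGordTwo W p →
        Upper.TwistUnitFieldOffSliverAt W p) :
    Upper.AdditiveX3RankOneUpper :=
  closes hF ControlFacts_holds (UpperRowPrimes.gordTwoBranchCoIMCField_of_rowPrimes hM hJ h3)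
    (UpperRowPrimes.potMultBranchCoIMC_of_rowPrimes hM hJ h4) (twistUnitX3OffSliver_of_rowPrimes hM hJ hTM hTG)

end Summit.BirchSwinnertonDyer.BirchSwinnertonDyer.Theorems.SchneiderFreeAdditiveX3.UpperLeafRowPrimes

end
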